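import Summits.QuantumFields.YangMills.Theorems.AlphaInputsT3ACHistories
import Summits.QuantumFields.YangMills.Theorems.UnitScaleTiltHistoryTailLaneTowerReach

/-!
# Route `UnitScaleTilt` — crux K2-L `HistoryTailL` (stmt-QuantumFields-19936), STUB 4c `stub_diluteExponent`: THE CORNER BLOCKS `Δ′(p′)` OF A SET OF
# LARGE-FIELD PLAQUETTES OVERLAP WITH BOUNDED MULTIPLICITY — a fine site lies in `Δ′(p′)` (print's «Δ′ = B^j(x₀) ∪ B^j(y₀) ∪ B^j(z₀) ∪ B^j(w₀)», (70) p.273)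
# for at most `4·d²` level-`i` plaquettes `p′`, so the localised actions `Σ_{p′ ∈ C} Σ_{q ⊂ Δ′(p′)} T(q)` of a cluster `C` over-count the action of the union
# `⋃_{p′ ∈ C} Δ′(p′)` at most `4·d²` times (support file; the multiplicity constant `μ₀` of the cluster bookkeeping of the dilute-family exponent bound)

Fleet lead `ym-ust-18916-p1` (gen 3), 2026-08-27.  Inputs: the lane's `AdmissibleRegions.card_sources_le_four` (seat p4: a fine site is covered by at most four
level-`i` plaquettes of a given orientation) and alpha-1's bridge `coarsen_toFine` between the interface's `toFine`/`cubeIdx` blocks and the lane's `coarsen`.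

* §1 `coarsen_eq_of_cubeIdx_eq_toFine` (a fine site in the `cubeIdx (L^i)`-block of `toFine i c` coarsens to `c`), **`mem_plaqCover_of_mem_blockAround`**
  (`Δ′(p′) ⊆ plaqCover p′` — the interface's corner blocks are the lane's cover);
* §2 **`card_filter_plaqCover_le`** (`#{p′ ∈ C | y ∈ plaqCover p′} ≤ 4·d²`), `card_filter_blockAround_le`;
* §3 `sum_sum_le_mul_sum_biUnion` (double counting with multiplicity, `f ≥ 0`), **`sum_localised_le`**:
  `Σ_{p′ ∈ C} Σ_{q ∈ plaqsIn 0 Δ′(p′)} f(q) ≤ 4d²·Σ_{q ∈ ⋃_{p′∈C} plaqsIn 0 Δ′(p′)} f(q)` for `f ≥ 0`.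

References: T. Bałaban, CMP 102 (1985) 255–275 [Balaban1985UV3] ((69)–(71) p.273).
-/

noncomputable section

open scoped BigOperators

namespace Summit.QuantumFields.YangMills.Theorems.HistoryTailCornerBlocks

open Literature.MathematicalPhysics.QuantumFieldTheory.Balaban1983to89
open Literature.MathematicalPhysics.QuantumFieldTheory.Balaban1983to89.T3ContinuumYM3Torus
open B10Eq38TorusDomains (toFine cornerSet plaqsIn mem_plaqsIn_iff)
open B3Ineq314Cubes (cubeIdx)
open T3AlphaInputsACSchemas (blockAround)
open Summit.QuantumFields.Balaban3D.Carriers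
open Summit.QuantumFields.Balaban3D.Proofs.AdmissibleRegions (card_sources_le_four)
open Summit.QuantumFields.YangMills.Theorems (coarsen_toFine)
open Summit.QuantumFields.YangMills.Theorems.HistoryTailLaneTowerReach (val_coarsen)

/-! ## §1 The interface's corner blocks lie in the lane's cover -/

section Generic

variable {P : Params}

/-- A fine site in the `cubeIdx (L^i)`-block of `toFine i c` coarsens to `c`. [cite: Balaban1985UV3, (38) p.266] -/
theorem coarsen_eq_of_cubeIdx_eq_toFine {i : ℕ} (hi : i ≤ P.m + P.K) {y : Site P 0} {c : Site P i}
    (h : cubeIdx (P.L ^ i) y = cubeIdx (P.L ^ i) (toFine i c)) : coarsen i y = c := by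
  funext μ
  apply ZMod.val_injective
  have hμ : (y μ).val / P.L ^ i = ((toFine i c) μ).val / P.L ^ i := congrFun h μ
  rw [val_coarsen i hi y μ, hμ, ← val_coarsen i hi (toFine i c) μ, coarsen_toFine i hi c]

end Generic

variable (F : T3Family)

/-- **`Δ′(p′) ⊆ plaqCover p′`**: the interface's union of the four corner blocks of a level-`i` plaquette (`T3AlphaInputsAC.blockAround`, `cubeIdx`-blocks of the
`toFine` representatives) lies in the lane's `plaqCover` (all fine sites coarsening to a corner). [cite: Balaban1985UV3, (70) p.273] -/
theorem mem_plaqCover_of_mem_blockAround {K i : ℕ} (hi : i ≤ (F.P K).m + (F.P K).K) {p : Plaq (F.P K) i} {y : Site (F.P K) 0}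
    (hy : y ∈ blockAround K i p) : y ∈ plaqCover p := by
  obtain ⟨x, hx, hxy⟩ := hy
  simp only [cornerSet, Set.mem_insert_iff, Set.mem_singleton_iff] at hx
  have hLF : F.L ^ i = (F.P K).L ^ i := rfl
  rw [hLF] at hxy
  show coarsen i y = p.src ∨ coarsen i y = p.src.shift p.μ ∨ coarsen i y = p.src.shift p.ν ∨
    coarsen i y = (p.src.shift p.μ).shift p.ν
  rcases hx with hx | hx | hx | hx <;> rw [hx] at hxy
  · exact Or.inl (coarsen_eq_of_cubeIdx_eq_toFine hi hxy)
  · exact Or.inr (Or.inl (coarsen_eq_of_cubeIdx_eq_toFine hi hxy))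
  · exact Or.inr (Or.inr (Or.inl (coarsen_eq_of_cubeIdx_eq_toFine hi hxy)))
  · exact Or.inr (Or.inr (Or.inr (coarsen_eq_of_cubeIdx_eq_toFine hi hxy)))

/-! ## §2 Bounded multiplicity of the covers -/

section Multiplicity

variable {P : Params}

open Classical in
/-- **A FINE SITE IS COVERED BY AT MOST `4·d²` PLAQUETTES OF A LEVEL** (four per orientation, `card_sources_le_four`). [cite: Balaban1985UV3, (70) p.273] -/
theorem card_filter_plaqCover_le {i : ℕ} (y : Site P 0) (C : Finset (Plaq P i)) :
    (C.filter fun p => y ∈ plaqCover p).card ≤ 4 * (P.d * P.d) := by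
  set s := C.filter fun p => y ∈ plaqCover p with hs
  have hmaps : (s : Set (Plaq P i)).MapsTo (fun p => (p.μ, p.ν)) (Finset.univ ×ˢ Finset.univ : Finset (Fin P.d × Fin P.d)) :=
    fun p _ => Finset.mem_product.mpr ⟨Finset.mem_univ _, Finset.mem_univ _⟩
  rw [Finset.card_eq_sum_card_fiberwise hmaps]
  calc ∑ b ∈ (Finset.univ ×ˢ Finset.univ : Finset (Fin P.d × Fin P.d)), (s.filter fun p => (p.μ, p.ν) = b).card
      ≤ ∑ _b ∈ (Finset.univ ×ˢ Finset.univ : Finset (Fin P.d × Fin P.d)), 4 := by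
        refine Finset.sum_le_sum fun b _ => ?_
        by_cases hb : b.1 < b.2
        · refine card_sources_le_four y b.1 b.2 hb _ fun p hp => ?_
          rw [Finset.mem_filter] at hp
          obtain ⟨hpS, hpb⟩ := hp
          rw [hs, Finset.mem_filter] at hpS
          exact ⟨(congrArg Prod.fst hpb :), (congrArg Prod.snd hpb :), hpS.2⟩
        · have hempty : (s.filter fun p => (p.μ, p.ν) = b) = ∅ := by
            refine Finset.filter_eq_empty_iff.mpr fun p _ hpb => hb ?_
            have h1 : p.μ = b.1 := congrArg Prod.fst hpb
            have h2 : p.ν = b.2 := congrArg Prod.snd hpb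
            rw [← h1, ← h2]; exact p.hμν
          rw [hempty, Finset.card_empty]; omega
    _ = 4 * (P.d * P.d) := by
        rw [Finset.sum_const, Finset.card_product, Finset.card_univ, Fintype.card_fin, smul_eq_mul]; ring

end Multiplicity

open Classical in
/-- The same for the interface's corner blocks `Δ′(p′)` (standing range `i ≤ m + K`). [cite: Balaban1985UV3, (70) p.273] -/
theorem card_filter_blockAround_le {K i : ℕ} (hi : i ≤ (F.P K).m + (F.P K).K) (y : Site (F.P K) 0) (C : Finset (Plaq (F.P K) i)) :
    (C.filter fun p => y ∈ blockAround K i p).card ≤ 4 * ((F.P K).d * (F.P K).d) := by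
  refine le_trans (Finset.card_le_card ?_) (card_filter_plaqCover_le y C)
  intro p hp
  rw [Finset.mem_filter] at hp ⊢
  exact ⟨hp.1, mem_plaqCover_of_mem_blockAround F hi hp.2⟩

/-! ## §3 Double counting with multiplicity -/

section DoubleCounting

variable {ι α : Type*} [DecidableEq α]

open Classical in
/-- **DOUBLE COUNTING WITH MULTIPLICITY**: if every element lies in at most `m` of the sets `S p`, `p ∈ C`, then for `f ≥ 0`
`Σ_{p ∈ C} Σ_{a ∈ S p} f a ≤ m·Σ_{a ∈ ⋃_{p∈C} S p} f a`. [folklore] -/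
theorem sum_sum_le_mul_sum_biUnion (C : Finset ι) (S : ι → Finset α) (f : α → ℝ) (hf : ∀ a, 0 ≤ f a) (m : ℕ)
    (hm : ∀ a ∈ C.biUnion S, (C.filter fun p => a ∈ S p).card ≤ m) :
    ∑ p ∈ C, ∑ a ∈ S p, f a ≤ (m : ℝ) * ∑ a ∈ C.biUnion S, f a := by
  have hswap : ∑ p ∈ C, ∑ a ∈ S p, f a = ∑ a ∈ C.biUnion S, ((C.filter fun p => a ∈ S p).card : ℝ) * f a := by
    have h1 : ∀ p ∈ C, ∑ a ∈ S p, f a = ∑ a ∈ C.biUnion S, if a ∈ S p then f a else 0 := by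
      intro p hp
      rw [← Finset.sum_filter]
      congr 1
      ext a
      simp only [Finset.mem_filter, Finset.mem_biUnion]
      exact ⟨fun ha => ⟨⟨p, hp, ha⟩, ha⟩, fun h => h.2⟩
    rw [Finset.sum_congr rfl h1, Finset.sum_comm]
    refine Finset.sum_congr rfl fun a _ => ?_
    rw [Finset.card_filter, Nat.cast_sum, Finset.sum_mul]
    refine Finset.sum_congr rfl fun p _ => ?_
    split_ifs <;> simp
  rw [hswap, Finset.mul_sum]
  exact Finset.sum_le_sum fun a ha => mul_le_mul_of_nonneg_right (by exact_mod_cast hm a ha) (hf a)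

end DoubleCounting

open Classical in
/-- **THE LOCALISED ACTIONS OF A SET OF LEVEL-`i` PLAQUETTES OVER-COUNT THE ACTION OF THE UNION OF THEIR CORNER BLOCKS AT MOST `4d²` TIMES**: for `f ≥ 0` on
fine plaquettes, `Σ_{p′ ∈ C} Σ_{q ∈ plaqsIn 0 Δ′(p′)} f(q) ≤ 4d²·Σ_{q ∈ ⋃_{p′ ∈ C} plaqsIn 0 Δ′(p′)} f(q)` (a fine plaquette `q ⊂ Δ′(p′)` has its base point in
`Δ′(p′) ⊆ plaqCover p′`). [cite: Balaban1985UV3, (70)-(71) p.273] -/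
theorem sum_localised_le {K i : ℕ} (hi : i ≤ (F.P K).m + (F.P K).K) (C : Finset (Plaq (F.P K) i)) (f : Plaq (F.P K) 0 → ℝ)
    (hf : ∀ q, 0 ≤ f q) :
    ∑ p ∈ C, ∑ q ∈ plaqsIn 0 (blockAround K i p), f q ≤
      (4 * ((F.P K).d * (F.P K).d) : ℕ) * ∑ q ∈ C.biUnion fun p => plaqsIn 0 (blockAround K i p), f q := by
  refine sum_sum_le_mul_sum_biUnion C (fun p => plaqsIn 0 (blockAround K i p)) f hf _ fun q _ => ?_
  refine le_trans (Finset.card_le_card fun p hp => ?_) (card_filter_blockAround_le F hi q.src C)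
  rw [Finset.mem_filter] at hp ⊢
  refine ⟨hp.1, ?_⟩
  have hsub : cornerSet 0 q ⊆ blockAround K i p := mem_plaqsIn_iff.mp hp.2
  exact hsub (by simp [cornerSet])

end Summit.QuantumFields.YangMills.Theorems.HistoryTailCornerBlocks

end
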